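import Summits.Ventures.GridStability.Lyapunov.DvocReducedSublevel
import Summits.Ventures.GridStability.Lyapunov.SublevelTrapping
import Literature.Analysis.ODE.LyapunovSublevelInvariance
import HarnessLib

/-!
# GridStability/Lyapunov/DvocReducedRoa — the a-priori ODE sentence for the reduced-order dVOC
# network (GrossEtAl2019 (17), Prop. 3): sublevel invariance and attraction to `𝒮 ∩ 𝒜`

Cell `gridfusion` (LADDER-GRIDFUSION), `plan/PARTITION.md` §0 row `Lyapunov/` + A20 (RULING 18,
TRACK T, step T2: «lyap-1 turns Prop. 3 into the a-priori ODE sentence under Lyapunov/»); seat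
gridfusion-lyap-1 (g3). File 2 of 2 (static half: `Lyapunov/DvocReducedSublevel.lean`; both in namespace
`Summit.Ventures.GridStability.Lyapunov.DvocReducedRoa`). INPUT =
lit-2's `Literature/MathematicalPhysics/PowerSystems/DVOCReducedNetworkLyapunov.lean` (p475771:
field (17) `W.field`, Lyapunov function (19) `W.V α₁`, `ψ` (21) `W.psi κ₀`, Prop. 3 (25)
`Vdot_le_neg_alpha1_psi_sq` from the instance properties `W.DecreaseOnS c` / `W.PhaseErrorBound κ₀`,
solutions `W.IsSolutionOn γ (Ici 0)`). OUTPUT (MODELLED column, model = the printed REDUCED-ORDER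
model (17) [cite: GrossEtAl2019, §IV-C eq. (17)]; nothing here says a converter or a grid is stable):

* `V_le_of_isSolutionOn` — along EVERY solution of (17) on `[0, ∞)`, `V` is non-increasing: every
  sublevel set `{V ≤ c'}` is positively invariant (Prop. 3, `V̇ ≤ −α₁ψ² ≤ 0`);
* `tendsto_infDist_target` — **the sentence**: under the hypotheses of Proposition 3 with `α > 0`
  (`η > 0`, `v_k* > 0`, `N ≥ 1`, `c, κ₀ > 0`, (23) `DecreaseOnS c`, `PhaseErrorBound κ₀`;
  `α₁ = c/(5ηκ₀²)` as printed (20)), EVERY solution `γ` with `V(γ 0) < V(0) = ½ η α α₁ Σ_k v_k*²`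
  has `dist(γ t, 𝒯) → 0`, `𝒯 = 𝒮 ∩ 𝒜 = {v ∈ 𝒮 | ‖v_k‖² = v_k*² ∀k}`; consequently
  `V(γ t) → 0` (`tendsto_V`), `‖γ t‖²_S → 0` (phase synchronisation, `tendsto_normS2`) and
  `‖γ_k(t)‖² → v_k*²` for every converter `k` (magnitude regulation, `tendsto_nsq`);
* `exists_isSolutionOn` — from EVERY initial state a solution of (17) on `[0, ∞)` exists (the field
  is polynomial, every sublevel set compact, `V̇ ≤ 0`: lit-6's
  `Literature.Analysis.ODE.exists_global_solution_of_sublevel`), so the sentence is not vacuous;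
  `sublevel_subset_regionOfAttraction` packages existence + invariance + attraction.

The analysis is this seat's curve-form layer `Lyapunov/SublevelTrapping.lean`
(`tendsto_infDist_dissipation_zero`: attraction to the zero SET of the dissipation rate on a compact
forward-invariant set — Rouche–Habets–Laloy Ch. I Thm 6.2 (a) run with a general rate). The target is
a set (a circle's worth of synchronous states), not a point, so neither the strict-minimum attraction
theorem of `LyapunovSublevelInvariance.lean` nor Barbashin–Krasovskii (`LyapunovBarbashinKrasovskii`,
attraction to a point under `V̇ ≤ 0`) is the tool, and no invariance principle is needed:
`V̇ ≤ −α₁ψ²` is STRICT off `𝒯` on `{V < V(0)}` (`mem_target_of_psi_eq_zero`).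
WHY the level `V(0)` (refuter note): `v ≡ 0` solves (17) (`field_zero`) with
`V ≡ V(0)` and never approaches `𝒯`; the print's Theorem 1 discards it as a measure-zero set, the
kernel sentence by the strict sublevel — an inner estimate, as every certificate on this ladder.

THREE COLUMNS. CERTIFIED (per instance, elsewhere): `DecreaseOnS c`, `PhaseErrorBound κ₀` with
rational `c, κ₀ > 0` for the instance's `(α, v*, θ*, ‖Y‖)` — T3's Bench file (RULING 18: at D1 as a
gain region); then `sublevel_subset_regionOfAttraction` applies verbatim, for every `η > 0`.
MODELLED: reduced-order model (17) = [GrossEtAl2019] Assumption 1 (uniform `ℓ/r`), Condition 1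
(consistent set-points, traded for `θ*` by Prop. 1), quasi-steady-state lines `i_o = i_o^s(v)`; the
line-dynamics upgrade is the print's Theorem 2 (singular perturbation) — LITERATURE, not asserted.
VALIDATED: nothing. No definition, no named fact; standard axioms.
-/

noncomputable section

open Set Filter Metric Topology
open Literature.MathematicalPhysics.PowerSystems

namespace Summit.Ventures.GridStability.Lyapunov.DvocReducedRoa

variable {N : ℕ} {W : DvocReduced N}

/-! ### Solutions of (17) on `[0, ∞)`: from lit-2's convention to the curve-form hypotheses -/

/-- A solution of (17) on `[0, ∞)` in lit-2's sense (`HasDerivWithinAt` within `Ici 0`) is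
continuous on `[0, ∞)`. [folklore] -/
theorem continuousOn_of_isSolutionOn {γ : ℝ → DvocState N} (hγ : W.IsSolutionOn γ (Ici 0)) :
    ContinuousOn γ (Ici 0) := fun t ht => (hγ t ht).continuousWithinAt

/-- … and has right derivative `f(γ t)` at every `t ≥ 0` (the convention of
`Lyapunov/SublevelTrapping.lean`). [folklore] -/
theorem hasDerivWithinAt_Ici_of_isSolutionOn {γ : ℝ → DvocState N}
    (hγ : W.IsSolutionOn γ (Ici 0)) {t : ℝ} (ht : 0 ≤ t) :
    HasDerivWithinAt γ (W.field (γ t)) (Ici t) t :=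
  (hγ t ht).mono (Ici_subset_Ici.2 ht)

/-- Along a solution of (17), `V ∘ γ` has right derivative the printed (26) `Vdot (γ t)` (lit-2's
`hasDerivWithinAt_V`). [cite: GrossEtAl2019, eq. (26)] -/
theorem hasDerivWithinAt_V_of_isSolutionOn (α₁ : ℝ) {γ : ℝ → DvocState N}
    (hγ : W.IsSolutionOn γ (Ici 0)) {t : ℝ} (ht : 0 ≤ t) :
    HasDerivWithinAt (W.V α₁ ∘ γ) (W.Vdot α₁ (γ t)) (Ici t) t :=
  W.hasDerivWithinAt_V α₁ (hasDerivWithinAt_Ici_of_isSolutionOn hγ ht)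

/-! ### Every sublevel set of (19) is positively invariant -/

/-- **`V` is non-increasing along every solution of (17)** (Prop. 3: `V̇ ≤ −α₁ψ² ≤ 0`), hence every
sublevel set `{V ≤ c'}` is positively invariant — the hypotheses are those of
[GrossEtAl2019, Prop. 3] in lit-2's instance form (`η > 0`, `α ≥ 0`, `v_k* > 0`, `c, κ₀ > 0`,
(23) `DecreaseOnS c`, phase-error bound `κ₀`). MODELLED: a statement about the reduced model (17).
[cite: GrossEtAl2019, Prop. 3] -/
theorem V_le_of_isSolutionOn [NeZero N] (hη : 0 < W.η) (hα : 0 ≤ W.α) (hv : ∀ k, 0 < W.vref k)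
    {c κ₀ : ℝ} (hc : 0 < c) (hκ₀ : 0 < κ₀) (h23 : W.DecreaseOnS c) (hK : W.PhaseErrorBound κ₀)
    {γ : ℝ → DvocState N} (hγ : W.IsSolutionOn γ (Ici 0)) {s t : ℝ} (hs : 0 ≤ s) (hst : s ≤ t) :
    W.V (W.alpha1 c κ₀) (γ t) ≤ W.V (W.alpha1 c κ₀) (γ s) := by
  have hα₁ : 0 ≤ W.alpha1 c κ₀ := by unfold DvocReduced.alpha1; positivity
  have hcont : ContinuousOn (W.V (W.alpha1 c κ₀) ∘ γ) (Icc 0 t) :=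
    (continuous_V W _).comp_continuousOn ((continuousOn_of_isSolutionOn hγ).mono Icc_subset_Ici_self)
  have h := antitoneOn_of_deriv_right_nonpos (a := 0) (b := t) hcont
    (fun u hu => hasDerivWithinAt_V_of_isSolutionOn _ hγ hu.1)
    (fun u _ => by
      have h1 := W.Vdot_le_neg_alpha1_psi_sq hη hα hv hc hκ₀ h23 hK (γ u)
      nlinarith [sq_nonneg (W.psi κ₀ (γ u))])
  exact h ⟨hs, hst⟩ ⟨hs.trans hst, le_rfl⟩ hst

/-! ### The sentence: attraction to `𝒮 ∩ 𝒜` -/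

/-- **Attraction of the reduced dVOC network to the synchronous set at nominal amplitude (a-priori
form of [GrossEtAl2019, Prop. 3 ⇒ Thm 1 for (17)], on the sublevel `{V < V(0)}`).** Hypotheses:
gains `η > 0`, `α > 0`, set-points `v_k* > 0` (`N ≥ 1`), a margin `c > 0` with the decrease
inequality (23) `DecreaseOnS c` and a phase-error bound `κ₀ > 0` (`PhaseErrorBound κ₀`) — the two
instance properties a Bench certificate discharges; `α₁ = c/(5ηκ₀²)` as printed (20). Conclusion:
for EVERY solution `γ` of (17) on `[0, ∞)` with `V(γ 0) < V(0) = ½ η α α₁ Σ_k v_k*²`, the distance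
from `γ t` to `𝒯 = 𝒮 ∩ 𝒜 = {v ∈ 𝒮 | ‖v_k‖² = v_k*² ∀k}` tends to `0`. Proof: the forward orbit
lies in the compact sublevel set `{V ≤ V(γ 0)}` (`V_le_of_isSolutionOn`, `isCompact_sublevel`), on
which `V̇ ≤ −α₁ψ²` with `α₁ψ²` continuous, `≥ 0`, and `= 0` exactly on `𝒯`
(`mem_target_of_psi_eq_zero`); `Lyapunov.tendsto_infDist_dissipation_zero`. MODELLED: reduced-order
model (17) only; no sentence about a converter or a grid. [cite: GrossEtAl2019, Prop. 3] -/
theorem tendsto_infDist_target [NeZero N] (hη : 0 < W.η) (hα : 0 < W.α) (hv : ∀ k, 0 < W.vref k)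
    {c κ₀ : ℝ} (hc : 0 < c) (hκ₀ : 0 < κ₀) (h23 : W.DecreaseOnS c) (hK : W.PhaseErrorBound κ₀)
    {γ : ℝ → DvocState N} (hγ : W.IsSolutionOn γ (Ici 0))
    (h0 : W.V (W.alpha1 c κ₀) (γ 0) < 1 / 2 * W.η * W.α * W.alpha1 c κ₀ * W.Lam) :
    Tendsto (fun t => infDist (γ t) {v | W.InS v ∧ ∀ k, dvocNsq v k = W.vref k ^ 2})
      atTop (𝓝 0) := by
  set α₁ := W.alpha1 c κ₀ with hα₁
  have hα₁pos : 0 < α₁ := by rw [hα₁]; unfold DvocReduced.alpha1; positivity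
  have hw : 0 < W.η * W.α * α₁ := by positivity
  have hΛ : W.Lam ≠ 0 := (W.Lam_pos hv).ne'
  have hne : ∀ k, W.vref k ≠ 0 := fun k => (hv k).ne'
  set c₀ := W.V α₁ (γ 0) with hc₀
  set S₀ : Set (DvocState N) := {v | W.V α₁ v ≤ c₀} with hS₀
  have hS₀c : IsCompact S₀ := isCompact_sublevel W hv hw c₀
  have hxS₀ : ∀ t, 0 ≤ t → γ t ∈ S₀ := fun t ht =>
    V_le_of_isSolutionOn hη hα.le hv hc hκ₀ h23 hK hγ le_rfl ht
  have hWc : ContinuousOn (fun y => α₁ * W.psi κ₀ y ^ 2) S₀ := by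
    have := continuous_psi W κ₀
    fun_prop
  have h := tendsto_infDist_dissipation_zero (F := W.field) (V := W.V α₁) (LV := W.Vdot α₁)
    (W := fun y => α₁ * W.psi κ₀ y ^ 2) (K := S₀) (x := γ) hS₀c (continuous_field W).continuousOn
    (continuous_V W α₁).continuousOn hWc (fun y _ => by positivity)
    (fun y _ => (W.Vdot_le_neg_alpha1_psi_sq hη hα.le hv hc hκ₀ h23 hK y).trans_eq (neg_mul _ _))
    (continuousOn_of_isSolutionOn hγ) (fun t ht => hasDerivWithinAt_Ici_of_isSolutionOn hγ ht)
    (fun t ht => hasDerivWithinAt_V_of_isSolutionOn α₁ hγ ht) hxS₀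
  -- the zero set of the dissipation rate on `S₀` IS `𝒮 ∩ 𝒜`
  have hZ : {y ∈ S₀ | α₁ * W.psi κ₀ y ^ 2 = 0}
      = {v | W.InS v ∧ ∀ k, dvocNsq v k = W.vref k ^ 2} := by
    ext y
    constructor
    · rintro ⟨hyS, hy0⟩
      have hψ : W.psi κ₀ y = 0 := by
        rcases mul_eq_zero.1 hy0 with h' | h'
        · exact absurd h' hα₁pos.ne'
        · exact (pow_eq_zero_iff (n := 2) (by norm_num)).1 h'
      exact mem_target_of_psi_eq_zero W hη hα hv hκ₀ hψ (lt_of_le_of_lt hyS h0)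
    · intro hy
      refine ⟨?_, ?_⟩
      · show W.V α₁ y ≤ c₀
        rw [V_eq_zero_of_mem_target W hne hΛ hw hy]
        exact W.V_nonneg hΛ hw.le (γ 0)
      · show α₁ * W.psi κ₀ y ^ 2 = 0
        rw [psi_eq_zero_of_mem_target W hΛ κ₀ hy]
        ring
  rw [hZ] at h
  exact h

/-- **`V(γ t) → 0`** under the hypotheses of `tendsto_infDist_target`: `V` is uniformly continuous on
the compact `{V ≤ V(γ 0)} ⊇ 𝒯`, vanishes on `𝒯` (`V_eq_zero_of_mem_target`), and `𝒯 ∋ S(1,0)` is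
nonempty. [cite: GrossEtAl2019, Prop. 3] -/
theorem tendsto_V [NeZero N] (hη : 0 < W.η) (hα : 0 < W.α) (hv : ∀ k, 0 < W.vref k)
    {c κ₀ : ℝ} (hc : 0 < c) (hκ₀ : 0 < κ₀) (h23 : W.DecreaseOnS c) (hK : W.PhaseErrorBound κ₀)
    {γ : ℝ → DvocState N} (hγ : W.IsSolutionOn γ (Ici 0))
    (h0 : W.V (W.alpha1 c κ₀) (γ 0) < 1 / 2 * W.η * W.α * W.alpha1 c κ₀ * W.Lam) :
    Tendsto (fun t => W.V (W.alpha1 c κ₀) (γ t)) atTop (𝓝 0) := by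
  have h := tendsto_infDist_target hη hα hv hc hκ₀ h23 hK hγ h0
  set α₁ := W.alpha1 c κ₀ with hα₁
  have hα₁pos : 0 < α₁ := by rw [hα₁]; unfold DvocReduced.alpha1; positivity
  have hw : 0 < W.η * W.α * α₁ := by positivity
  have hΛ : W.Lam ≠ 0 := (W.Lam_pos hv).ne'
  have hne : ∀ k, W.vref k ≠ 0 := fun k => (hv k).ne'
  set c₀ := W.V α₁ (γ 0) with hc₀
  set S₀ : Set (DvocState N) := {v | W.V α₁ v ≤ c₀} with hS₀
  have hS₀c : IsCompact S₀ := isCompact_sublevel W hv hw c₀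
  have hxS₀ : ∀ t, 0 ≤ t → γ t ∈ S₀ := fun t ht =>
    V_le_of_isSolutionOn hη hα.le hv hc hκ₀ h23 hK hγ le_rfl ht
  set T : Set (DvocState N) := {v | W.InS v ∧ ∀ k, dvocNsq v k = W.vref k ^ 2} with hT
  have hTne : T.Nonempty := ⟨W.embS 1 0, embS_one_zero_mem_target W⟩
  have hTS : T ⊆ S₀ := fun y hy => by
    show W.V α₁ y ≤ c₀
    rw [V_eq_zero_of_mem_target W hne hΛ hw hy]
    exact W.V_nonneg hΛ hw.le (γ 0)
  have huc := Metric.uniformContinuousOn_iff.1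
    (hS₀c.uniformContinuousOn_of_continuous (continuous_V W α₁).continuousOn)
  rw [Metric.tendsto_atTop] at h ⊢
  intro ε hε
  obtain ⟨δ, hδ, hVδ⟩ := huc ε hε
  obtain ⟨t₀, ht₀⟩ := h δ hδ
  refine ⟨max t₀ 0, fun t ht => ?_⟩
  have ht0 : 0 ≤ t := le_of_max_le_right ht
  have h1 := ht₀ t (le_of_max_le_left ht)
  rw [Real.dist_eq, sub_zero, abs_of_nonneg infDist_nonneg] at h1
  obtain ⟨z, hzT, hz⟩ := (infDist_lt_iff hTne).1 h1
  have h2 := hVδ (γ t) (hxS₀ t ht0) z (hTS hzT) hz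
  rw [V_eq_zero_of_mem_target W hne hΛ hw hzT] at h2
  exact h2

/-- **Phase synchronisation: `‖γ t‖²_S → 0`** (`0 ≤ ½‖v‖²_S ≤ V`). [cite: GrossEtAl2019, Prop. 3] -/
theorem tendsto_normS2 [NeZero N] (hη : 0 < W.η) (hα : 0 < W.α) (hv : ∀ k, 0 < W.vref k)
    {c κ₀ : ℝ} (hc : 0 < c) (hκ₀ : 0 < κ₀) (h23 : W.DecreaseOnS c) (hK : W.PhaseErrorBound κ₀)
    {γ : ℝ → DvocState N} (hγ : W.IsSolutionOn γ (Ici 0))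
    (h0 : W.V (W.alpha1 c κ₀) (γ 0) < 1 / 2 * W.η * W.α * W.alpha1 c κ₀ * W.Lam) :
    Tendsto (fun t => W.normS2 (γ t)) atTop (𝓝 0) := by
  have hV := tendsto_V hη hα hv hc hκ₀ h23 hK hγ h0
  have hα₁ : 0 < W.alpha1 c κ₀ := by unfold DvocReduced.alpha1; positivity
  have hw : 0 < W.η * W.α * W.alpha1 c κ₀ := by positivity
  have hΛ : W.Lam ≠ 0 := (W.Lam_pos hv).ne'
  refine squeeze_zero (fun t => W.normS2_nonneg hΛ (γ t)) (fun t => ?_)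
    (by simpa using hV.const_mul 2)
  have hpen : 0 ≤ ∑ k, (W.vref k ^ 2 - dvocNsq (γ t) k) ^ 2 / W.vref k ^ 2 :=
    Finset.sum_nonneg fun k _ => by positivity
  have hVdef : W.V (W.alpha1 c κ₀) (γ t) = 1 / 2 * W.normS2 (γ t) + 1 / 2 * W.η * W.α
      * W.alpha1 c κ₀ * ∑ k, (W.vref k ^ 2 - dvocNsq (γ t) k) ^ 2 / W.vref k ^ 2 := rfl
  nlinarith

/-- **Magnitude regulation: `‖γ_k(t)‖² → v_k*²` for every converter `k`**
(`(v_k*² − ‖v_k‖²)² ≤ (2 v_k*²/(ηαα₁)) V`). [cite: GrossEtAl2019, Prop. 3] -/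
theorem tendsto_nsq [NeZero N] (hη : 0 < W.η) (hα : 0 < W.α) (hv : ∀ k, 0 < W.vref k)
    {c κ₀ : ℝ} (hc : 0 < c) (hκ₀ : 0 < κ₀) (h23 : W.DecreaseOnS c) (hK : W.PhaseErrorBound κ₀)
    {γ : ℝ → DvocState N} (hγ : W.IsSolutionOn γ (Ici 0))
    (h0 : W.V (W.alpha1 c κ₀) (γ 0) < 1 / 2 * W.η * W.α * W.alpha1 c κ₀ * W.Lam) (k : Fin N) :
    Tendsto (fun t => dvocNsq (γ t) k) atTop (𝓝 (W.vref k ^ 2)) := by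
  have hV := tendsto_V hη hα hv hc hκ₀ h23 hK hγ h0
  set α₁ := W.alpha1 c κ₀ with hα₁
  have hα₁pos : 0 < α₁ := by rw [hα₁]; unfold DvocReduced.alpha1; positivity
  have hw : 0 < W.η * W.α * α₁ := by positivity
  have hΛ : W.Lam ≠ 0 := (W.Lam_pos hv).ne'
  have hvk : 0 < W.vref k ^ 2 := pow_pos (hv k) 2
  -- `(v_k*² − ‖γ_k‖²)² → 0`
  have hsq : Tendsto (fun t => (W.vref k ^ 2 - dvocNsq (γ t) k) ^ 2) atTop (𝓝 0) := by
    refine squeeze_zero (fun t => sq_nonneg _) (fun t => ?_)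
      (by simpa using hV.const_mul (2 * W.vref k ^ 2 / (W.η * W.α * α₁)))
    have hterm : ∀ j, 0 ≤ (W.vref j ^ 2 - dvocNsq (γ t) j) ^ 2 / W.vref j ^ 2 := fun j => by
      positivity
    have hk : (W.vref k ^ 2 - dvocNsq (γ t) k) ^ 2 / W.vref k ^ 2
        ≤ ∑ j, (W.vref j ^ 2 - dvocNsq (γ t) j) ^ 2 / W.vref j ^ 2 :=
      Finset.single_le_sum (fun j _ => hterm j) (Finset.mem_univ k)
    have hS := W.normS2_nonneg hΛ (γ t)
    have hVdef : W.V α₁ (γ t) = 1 / 2 * W.normS2 (γ t) + 1 / 2 * W.η * W.α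
        * α₁ * ∑ j, (W.vref j ^ 2 - dvocNsq (γ t) j) ^ 2 / W.vref j ^ 2 := rfl
    rw [div_le_iff₀ hvk] at hk
    rw [div_mul_eq_mul_div, le_div_iff₀ hw]
    nlinarith
  have habs : Tendsto (fun t => |W.vref k ^ 2 - dvocNsq (γ t) k|) atTop (𝓝 0) := by
    have h := hsq.sqrt
    simpa [Real.sqrt_sq_eq_abs] using h
  have hdiff : Tendsto (fun t => W.vref k ^ 2 - dvocNsq (γ t) k) atTop (𝓝 0) :=
    tendsto_zero_iff_norm_tendsto_zero.2 (by simpa only [Real.norm_eq_abs] using habs)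
  have h := (tendsto_const_nhds (x := W.vref k ^ 2) (f := (atTop : Filter ℝ))).sub hdiff
  simpa using h

/-! ### Existence: the sentence is not vacuous -/

/-- **From every initial state the reduced dVOC network (17) has a solution on `[0, ∞)`** (under the
hypotheses of Prop. 3 with `α > 0`): the field is `C¹` (`contDiff_field`), every sublevel set of
`V` is compact (`isCompact_sublevel`) and `DV·f = Vdot ≤ 0` (`fderiv_V_field`, Prop. 3), so lit-6's
`Literature.Analysis.ODE.exists_global_solution_of_sublevel` [RoucheHabetsLaloy1977 Ch. I Thm 6.2
(a)] applies with `G = M = univ`. [cite: GrossEtAl2019, Prop. 3] -/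
theorem exists_isSolutionOn [NeZero N] (hη : 0 < W.η) (hα : 0 < W.α) (hv : ∀ k, 0 < W.vref k)
    {c κ₀ : ℝ} (hc : 0 < c) (hκ₀ : 0 < κ₀) (h23 : W.DecreaseOnS c) (hK : W.PhaseErrorBound κ₀)
    (v₀ : DvocState N) : ∃ γ : ℝ → DvocState N, γ 0 = v₀ ∧ W.IsSolutionOn γ (Ici 0) := by
  set α₁ := W.alpha1 c κ₀ with hα₁
  have hα₁pos : 0 < α₁ := by rw [hα₁]; unfold DvocReduced.alpha1; positivity
  have hw : 0 < W.η * W.α * α₁ := by positivity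
  have hS : IsCompact {x | x ∈ (univ : Set (DvocState N)) ∩ univ ∧ W.V α₁ x ≤ W.V α₁ v₀} := by
    simpa using isCompact_sublevel W hv hw (W.V α₁ v₀)
  obtain ⟨X, hX0, hX⟩ := Literature.Analysis.ODE.exists_global_solution_of_sublevel
    (F := W.field) (V := W.V α₁) (V' := fun x => fderiv ℝ (W.V α₁) x) (G := univ) (M := univ)
    (c := W.V α₁ v₀) isOpen_univ
    (fun x _ => ((contDiff_V W α₁).differentiable one_ne_zero x).hasFDerivAt)
    (fun x _ => by
      rw [fderiv_V_field W α₁ x]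
      have h1 := W.Vdot_le_neg_alpha1_psi_sq hη hα.le hv hc hκ₀ h23 hK x
      nlinarith [sq_nonneg (W.psi κ₀ x)])
    hS (contDiff_field W) (x₀ := v₀) (by simp) (fun _ _ _ _ _ _ => mem_univ _)
  refine ⟨X, hX0, fun t ht => ?_⟩
  have ht' : (0 : ℝ) ≤ t := ht
  have hmem : Icc 0 (t + 1) ∈ 𝓝[Ici 0] t :=
    mem_of_superset (inter_mem_nhdsWithin (Ici (0 : ℝ)) (Iio_mem_nhds (by linarith)))
      fun s hs => ⟨hs.1, hs.2.le⟩
  exact ((hX (t + 1)) t ⟨ht', by linarith⟩).mono_of_mem_nhdsWithin hmem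

/-- **The «-roa» sentence for the reduced dVOC network, packaged** (RULING 18 Track T, T2): under
the hypotheses of [GrossEtAl2019, Prop. 3] with `α > 0` — i.e. at any instance whose Bench
certificate supplies `DecreaseOnS c` and `PhaseErrorBound κ₀` with rational `c, κ₀ > 0` — and for
every `η > 0`: from EVERY state `v₀` with `V(v₀) < V(0) = ½ηαα₁Σ_k v_k*²` a solution of (17) on
`[0, ∞)` exists, and EVERY such solution keeps `V ≤ V(v₀)`, approaches the synchronous set at
nominal amplitude `𝒯 = 𝒮 ∩ 𝒜` (`dist → 0`), has `‖·‖²_S → 0` and `‖v_k‖² → v_k*²` for all `k`.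
THREE COLUMNS: MODELLED sentence about the reduced-order model (17) under Assumption 1 /
Condition 1 / quasi-steady-state lines; CERTIFIED only once the two instance properties are
discharged by a kernel certificate; the print's almost-global Theorem 2 for the full model (15) is
LITERATURE, not asserted here. [cite: GrossEtAl2019, Prop. 3] -/
theorem sublevel_subset_regionOfAttraction [NeZero N] (hη : 0 < W.η) (hα : 0 < W.α)
    (hv : ∀ k, 0 < W.vref k) {c κ₀ : ℝ} (hc : 0 < c) (hκ₀ : 0 < κ₀) (h23 : W.DecreaseOnS c)
    (hK : W.PhaseErrorBound κ₀) {v₀ : DvocState N}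
    (h0 : W.V (W.alpha1 c κ₀) v₀ < 1 / 2 * W.η * W.α * W.alpha1 c κ₀ * W.Lam) :
    (∃ γ : ℝ → DvocState N, γ 0 = v₀ ∧ W.IsSolutionOn γ (Ici 0)) ∧
    ∀ γ : ℝ → DvocState N, W.IsSolutionOn γ (Ici 0) → γ 0 = v₀ →
      (∀ t, 0 ≤ t → W.V (W.alpha1 c κ₀) (γ t) ≤ W.V (W.alpha1 c κ₀) v₀) ∧
      Tendsto (fun t => infDist (γ t) {v | W.InS v ∧ ∀ k, dvocNsq v k = W.vref k ^ 2})
        atTop (𝓝 0) ∧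
      Tendsto (fun t => W.normS2 (γ t)) atTop (𝓝 0) ∧
      ∀ k, Tendsto (fun t => dvocNsq (γ t) k) atTop (𝓝 (W.vref k ^ 2)) := by
  refine ⟨exists_isSolutionOn hη hα hv hc hκ₀ h23 hK v₀, fun γ hγ hγ0 => ?_⟩
  rw [← hγ0] at h0
  exact ⟨fun t ht => hγ0 ▸ V_le_of_isSolutionOn hη hα.le hv hc hκ₀ h23 hK hγ le_rfl ht,
    tendsto_infDist_target hη hα hv hc hκ₀ h23 hK hγ h0,
    tendsto_normS2 hη hα hv hc hκ₀ h23 hK hγ h0,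
    fun k => tendsto_nsq hη hα hv hc hκ₀ h23 hK hγ h0 k⟩

end Summit.Ventures.GridStability.Lyapunov.DvocReducedRoa

end
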